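import Summits.CriticalPhenomena.PercolationContinuityZ3.Theses.PercSieveRigidity

/-!
# Birth skeleton (BC3) for the crux `FKGSieveRigidity` (stmt-CriticalPhenomena-11218)

Route `route-CriticalPhenomena-PercSieveRigidity` (sub-problem `PercolationContinuityZ3`), crux decl
`Summit.CriticalPhenomena.PercolationContinuityZ3.Theses.PercSieveRigidity.FKGSieveRigidity` (rank 3,
"X of the thesis", difficulty open-problem): every probability measure `μ` on bond configurations of
`ℤ³` that is lattice-supported (H2), insertion-tolerant (H3), deletion-tolerant (H4), ergodic under
every non-zero translation (H5), automorphism-invariant (H6), positively associated (H7), WEAVING (H8),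
SIEVE-FRAGILE (H9) and obeys the EXIT LAW (H10) has `μ(|C(0)| = ∞) = 0`.

Notation (direction `i : Fin 3`, level `k : ℕ`). `D_k^i` is the dyadic single-edge sieve
`{s(z, z + e_i) : z ≡ 2^k · 𝟙 (mod 2^(k+1)) coordinatewise}` of the crux's exit law; `P_k = piece i k ω`
is the cluster of the origin in `ω ∖ D_k^i` (a.s. finite by H9); `U_k = |doors i k ω|` counts the OPEN
sieve edges with exactly one endpoint in `P_k` (verbatim the exit-law count of H10); and — the new
object of this line — `N_k = |centres i k ω|` counts the points of the period lattice
`Γ_k = 2^(k+1) ℤ³` lying in `P_k` (the origin is one of them, `zero_mem_centres`): the number of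
SIEVE CELLS the sieved piece of the origin visits at their centres.

THE LINE — "door tightness by centre transport; the crux is coarse tightness of the sieved piece".
The exit law says that on `A = {|C(0)| = ∞}` the door count diverges: `μ(A ∩ {U_k ≤ M}) → 0` for
each `M`. The translations by `Γ_k` preserve `D_k^i` and `μ` (H6), and the origin lies in `Γ_k`;
transporting unit mass from every lattice point `g ∈ Γ_k` to the inner endpoints of the open doors
of ITS piece, split evenly among the `N_k`-many lattice points of that piece, the mass sent from the
origin is `U_k / N_k`, while the mass received at a site is at most `1` and is non-zero only at the
two endpoints of the single sieve edge of a period cell. The mass-transport principle for the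
subgroup `Γ_k` (Lyons–Peres 2016 Thm. 8.7 / (8.10); PROVED in tree for subgroups of `Aut(G)`:
`Literature.Barriers.CriticalPhenomena.MassTransportPrincipleSubgroup`) gives `E_μ[U_k / N_k] ≤ 2`
uniformly in `k`, hence by Markov `μ(N_k ≤ N, U_k > M) ≤ 2N/M`: FEW CELLS ⇒ FEW DOORS
(STUB 2, `stub_doorTransport`, provable now, L-sized). Consequently the crux is EQUIVALENT (given
STUB 2 and the exit law, by the three-term budget
`μ(A) ≤ μ(A ∩ {U_k ≤ M}) + μ({N_k ≤ N} ∩ {U_k > M}) + μ({N_k > N})`, proved below) to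

* STUB 1 `stub_cellTightness` (OPEN, the hard step): under the ten class hypotheses the number
  `N_k` of level-`k` lattice points in the level-`k` sieved piece of the origin is TIGHT, uniformly in
  `k`: `∀ ε > 0 ∃ N ∀ k, μ(N_k > N) ≤ ε`. In words: a sieve-fragile, weaving, FKG, finite-energy,
  symmetric measure cannot have sieved pieces that sprawl over unboundedly many sieve cells at their
  own scale. In a hypothetical FKG needle weaver (the negation of the crux) the pieces MUST sprawl
  (`N_k → ∞` on `A`, by STUB 2 + exits): this is the sharpened portrait of the monster the line
  exposes, and the statement where FKG (H7), weaving (H8) and the reflections/rotations in H6 have to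
  bite. Off `A` tightness is automatic (`N_k ≤ |C(0)| < ∞`, and `N_k → 1`).

Neither stub alone gives the crux: STUB 2 holds for every automorphism-invariant sieve-fragile law,
percolating or not (it is an MTP identity), and STUB 1 says nothing about doors, so it meets the exit
law only through STUB 2. The composition `FKGSieveRigidity_of` is kernel-checked (no `sorry` outside
the two stubs): cover `A ⊆ (A ∩ {U_k ≤ M}) ∪ ({N_k ≤ N} ∩ {U_k > M}) ∪ {N_k > N}` (`cover`), the
union bound (`budget3`), the exit law at direction `0` to choose `k` (`exists_le_of_tendsto_zero`),
`μ.real A ≤ 3ε` for every `ε > 0`, hence `μ A = 0`.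

DISPROOF USED: none exists for this crux (`ledger crux ls stmt-CriticalPhenomena-11218`: no
workfiles, no `Disproof.lean`, no landed `Theorems/FKGSieveRigidity/Negative/*`, 2026-08-17). Checked
instead against the two refuter crux-attack reports attached to the item (2026-08-15, SURVIVES ×2:
"soft MTP proof attempt yields only 'mean sieved piece at a door ≫ 8^(k+1)' — no contradiction"):
consistent — STUB 2 is exactly the provable MTP layer, and the line places the open content in
STUB 1, not in a transport identity. Negatives index of the summit: nothing on sieved pieces, doors
or period-lattice counts.
-/

noncomputable section

namespace Summit.CriticalPhenomena.PercolationContinuityZ3.Cruxes.FKGSieveRigidity.Birth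

open MeasureTheory Filter Literature.Probability.Percolation Literature.Probability.LatticeModels
open scoped Topology ENNReal
open Summit.CriticalPhenomena.PercolationContinuityZ3.Theses.PercSieveRigidity (FKGSieveRigidity)

/-! ## Objects of the line -/

/-- The level-`k` dyadic single-edge sieve in direction `i`:
`D_k^i = {s(z, z + e_i) : 2^(k+1) ∣ z_j − 2^k for all j}` (verbatim the sieve of the exit law H10). -/
def sieve (i : Fin 3) (k : ℕ) : Set (Sym2 (Site 3)) :=
  {e | ∃ z : Site 3, (∀ j, (2 : ℤ) ^ (k + 1) ∣ z j - 2 ^ k) ∧ e = s(z, z + Pi.single i 1)}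

/-- The sieved piece of the origin: its open cluster in `ω ∖ D_k^i`. -/
def piece (i : Fin 3) (k : ℕ) (ω : BondConfig (Site 3)) : Set (Site 3) :=
  openCluster (ω \ sieve i k) 0

/-- The open DOORS of the piece: lower endpoints `y` of OPEN sieve edges `s(y, y + e_i)` with exactly
one endpoint in the piece (verbatim the set counted by `U_k` in the exit law H10). -/
def doors (i : Fin 3) (k : ℕ) (ω : BondConfig (Site 3)) : Set (Site 3) :=
  {y | (∀ j, (2 : ℤ) ^ (k + 1) ∣ y j - 2 ^ k) ∧ s(y, y + Pi.single i 1) ∈ ω ∧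
    (y ∈ piece i k ω ↔ y + Pi.single i 1 ∉ piece i k ω)}

/-- The CENTRES of the piece (the new object): points of the period lattice `Γ_k = 2^(k+1) ℤ³` lying
in the sieved piece of the origin. -/
def centres (i : Fin 3) (k : ℕ) (ω : BondConfig (Site 3)) : Set (Site 3) :=
  {g | (∀ j, (2 : ℤ) ^ (k + 1) ∣ g j) ∧ g ∈ piece i k ω}

/-- Event `{U_k ≤ M}`: at most `M` open doors. -/
def fewDoors (i : Fin 3) (k M : ℕ) : Set (BondConfig (Site 3)) :=
  {ω | (doors i k ω).encard ≤ (M : ℕ∞)}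

/-- Event `{U_k > M}`: more than `M` open doors. -/
def manyDoors (i : Fin 3) (k M : ℕ) : Set (BondConfig (Site 3)) :=
  {ω | (M : ℕ∞) < (doors i k ω).encard}

/-- Event `{N_k ≤ N}`: the piece meets at most `N` lattice points of `Γ_k`. -/
def fewCentres (i : Fin 3) (k N : ℕ) : Set (BondConfig (Site 3)) :=
  {ω | (centres i k ω).encard ≤ (N : ℕ∞)}

/-- Event `{N_k > N}`: the piece sprawls over more than `N` lattice points of `Γ_k`. -/
def manyCentres (i : Fin 3) (k N : ℕ) : Set (BondConfig (Site 3)) :=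
  {ω | (N : ℕ∞) < (centres i k ω).encard}

/-- The ten class hypotheses H1–H10 of the crux at the measure `μ`, as an implication towards `concl`
(binder texts verbatim those of `FKGSieveRigidity`). -/
def Hyps (μ : Measure (BondConfig (Site 3))) (concl : Prop) : Prop :=
    MeasureTheory.IsProbabilityMeasure μ →
    (∀ᵐ ω ∂μ, ω ⊆ (Literature.Probability.LatticeModels.zdGraph 3).edgeSet) →
    (∀ N : ℕ, ∃ c : ℝ, 0 < c ∧ ∀ S : Set (Literature.Probability.Percolation.BondConfig
    (Literature.Probability.LatticeModels.Site 3)), MeasurableSet S → c * μ.real ((fun ω :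
    Literature.Probability.Percolation.BondConfig (Literature.Probability.LatticeModels.Site 3) => ω
    ∪ ↑(Literature.Probability.LatticeModels.edgesIn (Literature.Probability.LatticeModels.zdGraph
    3) (Literature.Probability.LatticeModels.box 3 N))) ⁻¹' S) ≤ μ.real S) →
    (∀ N : ℕ, ∃ c : ℝ, 0 < c ∧ ∀ S : Set (Literature.Probability.Percolation.BondConfig
    (Literature.Probability.LatticeModels.Site 3)), MeasurableSet S → c * μ.real ((fun ω :
    Literature.Probability.Percolation.BondConfig (Literature.Probability.LatticeModels.Site 3) => ω
    \ ↑(Literature.Probability.LatticeModels.edgesIn (Literature.Probability.LatticeModels.zdGraph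
    3) (Literature.Probability.LatticeModels.box 3 N))) ⁻¹' S) ≤ μ.real S) →
    (∀ v : Literature.Probability.LatticeModels.Site 3, v ≠ 0 → Ergodic
    (Literature.Probability.Percolation.BondConfig.relabel
    (Literature.Probability.Percolation.sym2Equiv (Literature.Probability.LatticeModels.Site.shift
    v))) μ) →
    (∀ (γ : Literature.Probability.LatticeModels.zdGraph 3 ≃g
    Literature.Probability.LatticeModels.zdGraph 3) (A : Set
    (Literature.Probability.Percolation.BondConfig (Literature.Probability.LatticeModels.Site 3))),
    MeasurableSet A → μ (Literature.Probability.Percolation.BondConfig.relabel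
    (Literature.Probability.Percolation.sym2Equiv γ.toEquiv) ⁻¹' A) = μ A) →
    (∀ A B : Set (Literature.Probability.Percolation.BondConfig
    (Literature.Probability.LatticeModels.Site 3)), IsUpperSet A → IsUpperSet B → MeasurableSet A →
    MeasurableSet B → μ A * μ B ≤ μ (A ∩ B)) →
    (∀ᵐ ω ∂μ, ∀ (i : Fin 3) (a : ℤ) (v : Literature.Probability.LatticeModels.Site 3), {y :
    Literature.Probability.LatticeModels.Site 3 | ω ∈ Literature.Probability.Percolation.openConnIn
    {x : Literature.Probability.LatticeModels.Site 3 | a ≤ x i} v y}.Finite ∧ {y :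
    Literature.Probability.LatticeModels.Site 3 | ω ∈ Literature.Probability.Percolation.openConnIn
    {x : Literature.Probability.LatticeModels.Site 3 | x i ≤ a} v y}.Finite) →
    (∀ L : ℕ, 1 ≤ L → ∀ (i : Fin 3) (c : Literature.Probability.LatticeModels.Site 3), ∀ᵐ ω ∂μ, ∀ x
    : Literature.Probability.LatticeModels.Site 3, (Literature.Probability.Percolation.openCluster
    (ω \ {e | ∃ y : Literature.Probability.LatticeModels.Site 3, (∀ j, (L : ℤ) ∣ y j - c j) ∧ e =
    s(y, y + Pi.single i 1)}) x).Finite) →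
    (∀ (i : Fin 3) (M : ℕ), Filter.Tendsto (fun k : ℕ => μ.real ({ω |
    (Literature.Probability.Percolation.openCluster ω 0).Infinite} ∩ {ω | {y :
    Literature.Probability.LatticeModels.Site 3 | (∀ j, (2 : ℤ) ^ (k + 1) ∣ y j - 2 ^ k) ∧ s(y, y +
    Pi.single i 1) ∈ ω ∧ (y ∈ Literature.Probability.Percolation.openCluster (ω \ {e | ∃ z :
    Literature.Probability.LatticeModels.Site 3, (∀ j, (2 : ℤ) ^ (k + 1) ∣ z j - 2 ^ k) ∧ e = s(z, z
    + Pi.single i 1)}) 0 ↔ y + Pi.single i 1 ∉ Literature.Probability.Percolation.openCluster (ω \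
    {e | ∃ z : Literature.Probability.LatticeModels.Site 3, (∀ j, (2 : ℤ) ^ (k + 1) ∣ z j - 2 ^ k) ∧
    e = s(z, z + Pi.single i 1)}) 0)}.encard ≤ (M : ℕ∞)})) Filter.atTop (nhds 0)) →
    concl

/-- The crux in the local vocabulary: `FKGSieveRigidity` is literally `∀ μ, Hyps μ (μ {|C(0)| = ∞} = 0)`. -/
theorem fkgSieveRigidity_iff :
    FKGSieveRigidity ↔ ∀ μ : Measure (BondConfig (Site 3)), Hyps μ (μ (percolatesAt (0 : Site 3)) = 0) :=
  Iff.rfl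

/-! ## The two stub statements (spelled out over Literature declarations) -/

/-- STUB 1 statement — CELL TIGHTNESS: under H1–H10, the number of level-`k` lattice points in the
level-`k` sieved piece of the origin is tight, uniformly in `k` (for every direction `i`). -/
def CellTightness : Prop :=
  ∀ μ : MeasureTheory.Measure (Literature.Probability.Percolation.BondConfig
  (Literature.Probability.LatticeModels.Site 3)),
    MeasureTheory.IsProbabilityMeasure μ →
    (∀ᵐ ω ∂μ, ω ⊆ (Literature.Probability.LatticeModels.zdGraph 3).edgeSet) →
    (∀ N : ℕ, ∃ c : ℝ, 0 < c ∧ ∀ S : Set (Literature.Probability.Percolation.BondConfig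
    (Literature.Probability.LatticeModels.Site 3)), MeasurableSet S → c * μ.real ((fun ω :
    Literature.Probability.Percolation.BondConfig (Literature.Probability.LatticeModels.Site 3) => ω
    ∪ ↑(Literature.Probability.LatticeModels.edgesIn (Literature.Probability.LatticeModels.zdGraph
    3) (Literature.Probability.LatticeModels.box 3 N))) ⁻¹' S) ≤ μ.real S) →
    (∀ N : ℕ, ∃ c : ℝ, 0 < c ∧ ∀ S : Set (Literature.Probability.Percolation.BondConfig
    (Literature.Probability.LatticeModels.Site 3)), MeasurableSet S → c * μ.real ((fun ω :
    Literature.Probability.Percolation.BondConfig (Literature.Probability.LatticeModels.Site 3) => ω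
    \ ↑(Literature.Probability.LatticeModels.edgesIn (Literature.Probability.LatticeModels.zdGraph
    3) (Literature.Probability.LatticeModels.box 3 N))) ⁻¹' S) ≤ μ.real S) →
    (∀ v : Literature.Probability.LatticeModels.Site 3, v ≠ 0 → Ergodic
    (Literature.Probability.Percolation.BondConfig.relabel
    (Literature.Probability.Percolation.sym2Equiv (Literature.Probability.LatticeModels.Site.shift
    v))) μ) →
    (∀ (γ : Literature.Probability.LatticeModels.zdGraph 3 ≃g
    Literature.Probability.LatticeModels.zdGraph 3) (A : Set
    (Literature.Probability.Percolation.BondConfig (Literature.Probability.LatticeModels.Site 3))),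
    MeasurableSet A → μ (Literature.Probability.Percolation.BondConfig.relabel
    (Literature.Probability.Percolation.sym2Equiv γ.toEquiv) ⁻¹' A) = μ A) →
    (∀ A B : Set (Literature.Probability.Percolation.BondConfig
    (Literature.Probability.LatticeModels.Site 3)), IsUpperSet A → IsUpperSet B → MeasurableSet A →
    MeasurableSet B → μ A * μ B ≤ μ (A ∩ B)) →
    (∀ᵐ ω ∂μ, ∀ (i : Fin 3) (a : ℤ) (v : Literature.Probability.LatticeModels.Site 3), {y :
    Literature.Probability.LatticeModels.Site 3 | ω ∈ Literature.Probability.Percolation.openConnIn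
    {x : Literature.Probability.LatticeModels.Site 3 | a ≤ x i} v y}.Finite ∧ {y :
    Literature.Probability.LatticeModels.Site 3 | ω ∈ Literature.Probability.Percolation.openConnIn
    {x : Literature.Probability.LatticeModels.Site 3 | x i ≤ a} v y}.Finite) →
    (∀ L : ℕ, 1 ≤ L → ∀ (i : Fin 3) (c : Literature.Probability.LatticeModels.Site 3), ∀ᵐ ω ∂μ, ∀ x
    : Literature.Probability.LatticeModels.Site 3, (Literature.Probability.Percolation.openCluster
    (ω \ {e | ∃ y : Literature.Probability.LatticeModels.Site 3, (∀ j, (L : ℤ) ∣ y j - c j) ∧ e =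
    s(y, y + Pi.single i 1)}) x).Finite) →
    (∀ (i : Fin 3) (M : ℕ), Filter.Tendsto (fun k : ℕ => μ.real ({ω |
    (Literature.Probability.Percolation.openCluster ω 0).Infinite} ∩ {ω | {y :
    Literature.Probability.LatticeModels.Site 3 | (∀ j, (2 : ℤ) ^ (k + 1) ∣ y j - 2 ^ k) ∧ s(y, y +
    Pi.single i 1) ∈ ω ∧ (y ∈ Literature.Probability.Percolation.openCluster (ω \ {e | ∃ z :
    Literature.Probability.LatticeModels.Site 3, (∀ j, (2 : ℤ) ^ (k + 1) ∣ z j - 2 ^ k) ∧ e = s(z, z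
    + Pi.single i 1)}) 0 ↔ y + Pi.single i 1 ∉ Literature.Probability.Percolation.openCluster (ω \
    {e | ∃ z : Literature.Probability.LatticeModels.Site 3, (∀ j, (2 : ℤ) ^ (k + 1) ∣ z j - 2 ^ k) ∧
    e = s(z, z + Pi.single i 1)}) 0)}.encard ≤ (M : ℕ∞)})) Filter.atTop (nhds 0)) →
    ∀ (i : Fin 3) (ε : ℝ), 0 < ε → ∃ N : ℕ, ∀ k : ℕ, μ.real {ω | (N : ℕ∞) < {g :
    Literature.Probability.LatticeModels.Site 3 | (∀ j, (2 : ℤ) ^ (k + 1) ∣ g j) ∧ g ∈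
    Literature.Probability.Percolation.openCluster (ω \ {e | ∃ z :
    Literature.Probability.LatticeModels.Site 3, (∀ j, (2 : ℤ) ^ (k + 1) ∣ z j - 2 ^ k) ∧ e = s(z, z
    + Pi.single i 1)}) 0}.encard} ≤ ε

/-- STUB 2 statement — DOOR TRANSPORT: under H1 (probability), H6 (automorphism invariance) and H9
(sieve-fragility), pieces meeting at most `N` lattice points have a tight number of open doors,
uniformly in `k` (the mass-transport principle for `Γ_k`; expected bound `2N/M`). -/
def DoorTransport : Prop :=
  ∀ μ : MeasureTheory.Measure (Literature.Probability.Percolation.BondConfig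
  (Literature.Probability.LatticeModels.Site 3)),
    MeasureTheory.IsProbabilityMeasure μ →
    (∀ (γ : Literature.Probability.LatticeModels.zdGraph 3 ≃g
    Literature.Probability.LatticeModels.zdGraph 3) (A : Set
    (Literature.Probability.Percolation.BondConfig (Literature.Probability.LatticeModels.Site 3))),
    MeasurableSet A → μ (Literature.Probability.Percolation.BondConfig.relabel
    (Literature.Probability.Percolation.sym2Equiv γ.toEquiv) ⁻¹' A) = μ A) →
    (∀ L : ℕ, 1 ≤ L → ∀ (i : Fin 3) (c : Literature.Probability.LatticeModels.Site 3), ∀ᵐ ω ∂μ, ∀ x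
    : Literature.Probability.LatticeModels.Site 3, (Literature.Probability.Percolation.openCluster
    (ω \ {e | ∃ y : Literature.Probability.LatticeModels.Site 3, (∀ j, (L : ℤ) ∣ y j - c j) ∧ e =
    s(y, y + Pi.single i 1)}) x).Finite) →
    ∀ (i : Fin 3) (N : ℕ) (ε : ℝ), 0 < ε → ∃ M : ℕ, ∀ k : ℕ, μ.real ({ω | {g :
    Literature.Probability.LatticeModels.Site 3 | (∀ j, (2 : ℤ) ^ (k + 1) ∣ g j) ∧ g ∈
    Literature.Probability.Percolation.openCluster (ω \ {e | ∃ z :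
    Literature.Probability.LatticeModels.Site 3, (∀ j, (2 : ℤ) ^ (k + 1) ∣ z j - 2 ^ k) ∧ e = s(z, z
    + Pi.single i 1)}) 0}.encard ≤ (N : ℕ∞)} ∩ {ω | (M : ℕ∞) < {y :
    Literature.Probability.LatticeModels.Site 3 | (∀ j, (2 : ℤ) ^ (k + 1) ∣ y j - 2 ^ k) ∧ s(y, y +
    Pi.single i 1) ∈ ω ∧ (y ∈ Literature.Probability.Percolation.openCluster (ω \ {e | ∃ z :
    Literature.Probability.LatticeModels.Site 3, (∀ j, (2 : ℤ) ^ (k + 1) ∣ z j - 2 ^ k) ∧ e = s(z, z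
    + Pi.single i 1)}) 0 ↔ y + Pi.single i 1 ∉ Literature.Probability.Percolation.openCluster (ω \
    {e | ∃ z : Literature.Probability.LatticeModels.Site 3, (∀ j, (2 : ℤ) ^ (k + 1) ∣ z j - 2 ^ k) ∧
    e = s(z, z + Pi.single i 1)}) 0)}.encard}) ≤ ε

/-- `CellTightness` in the local vocabulary. -/
theorem cellTightness_iff :
    CellTightness ↔ ∀ μ : Measure (BondConfig (Site 3)),
      Hyps μ (∀ (i : Fin 3) (ε : ℝ), 0 < ε → ∃ N : ℕ, ∀ k : ℕ, μ.real (manyCentres i k N) ≤ ε) :=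
  Iff.rfl

/-- `DoorTransport` in the local vocabulary. -/
theorem doorTransport_iff :
    DoorTransport ↔ ∀ μ : Measure (BondConfig (Site 3)),
    MeasureTheory.IsProbabilityMeasure μ →
    (∀ (γ : Literature.Probability.LatticeModels.zdGraph 3 ≃g
    Literature.Probability.LatticeModels.zdGraph 3) (A : Set
    (Literature.Probability.Percolation.BondConfig (Literature.Probability.LatticeModels.Site 3))),
    MeasurableSet A → μ (Literature.Probability.Percolation.BondConfig.relabel
    (Literature.Probability.Percolation.sym2Equiv γ.toEquiv) ⁻¹' A) = μ A) →
    (∀ L : ℕ, 1 ≤ L → ∀ (i : Fin 3) (c : Literature.Probability.LatticeModels.Site 3), ∀ᵐ ω ∂μ, ∀ x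
    : Literature.Probability.LatticeModels.Site 3, (Literature.Probability.Percolation.openCluster
    (ω \ {e | ∃ y : Literature.Probability.LatticeModels.Site 3, (∀ j, (L : ℤ) ∣ y j - c j) ∧ e =
    s(y, y + Pi.single i 1)}) x).Finite) →
      ∀ (i : Fin 3) (N : ℕ) (ε : ℝ), 0 < ε → ∃ M : ℕ, ∀ k : ℕ,
        μ.real (fewCentres i k N ∩ manyDoors i k M) ≤ ε :=
  Iff.rfl

/-! ## Registered stubs (the only `sorry`s of the file) -/

/-- **STUB 1 `cellTightness`** (XL, OPEN — the hard step): for every `μ` satisfying the ten class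
hypotheses H1–H10 of the crux, every direction `i` and every `ε > 0` there is `N` with
`μ {ω | N < |Γ_k ∩ P_k^i(ω)|} ≤ ε` for ALL levels `k` (`Γ_k = 2^(k+1) ℤ³`, `P_k^i` the cluster of `0` in
`ω ∖ D_k^i`). Why plausibly true: it is implied by the crux (if `μ(A) = 0` then `N_k ≤ |C(0)| < ∞` and
`N_k → 1` a.s.), and it is where the unused hypotheses must act — a finite piece sprawling over `N ≫ 1`
cells of side `2^(k+1)` is enclosed by a closed dual surface punctured only at level-`k` sieve edges, at
every scale simultaneously, against FKG (H7), weaving (H8) and the full lattice symmetry (H6). Why it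
might fail: exactly when the crux fails — an FKG needle weaver has `N_k → ∞` on `A` (STUB 2 + exits);
no known theorem forbids sprawling finite pieces (route why-it-might-fail, card fkg-weaver-monotone-dag). -/
theorem stub_cellTightness :
  ∀ μ : MeasureTheory.Measure (Literature.Probability.Percolation.BondConfig
  (Literature.Probability.LatticeModels.Site 3)),
    MeasureTheory.IsProbabilityMeasure μ →
    (∀ᵐ ω ∂μ, ω ⊆ (Literature.Probability.LatticeModels.zdGraph 3).edgeSet) →
    (∀ N : ℕ, ∃ c : ℝ, 0 < c ∧ ∀ S : Set (Literature.Probability.Percolation.BondConfig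
    (Literature.Probability.LatticeModels.Site 3)), MeasurableSet S → c * μ.real ((fun ω :
    Literature.Probability.Percolation.BondConfig (Literature.Probability.LatticeModels.Site 3) => ω
    ∪ ↑(Literature.Probability.LatticeModels.edgesIn (Literature.Probability.LatticeModels.zdGraph
    3) (Literature.Probability.LatticeModels.box 3 N))) ⁻¹' S) ≤ μ.real S) →
    (∀ N : ℕ, ∃ c : ℝ, 0 < c ∧ ∀ S : Set (Literature.Probability.Percolation.BondConfig
    (Literature.Probability.LatticeModels.Site 3)), MeasurableSet S → c * μ.real ((fun ω :
    Literature.Probability.Percolation.BondConfig (Literature.Probability.LatticeModels.Site 3) => ω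
    \ ↑(Literature.Probability.LatticeModels.edgesIn (Literature.Probability.LatticeModels.zdGraph
    3) (Literature.Probability.LatticeModels.box 3 N))) ⁻¹' S) ≤ μ.real S) →
    (∀ v : Literature.Probability.LatticeModels.Site 3, v ≠ 0 → Ergodic
    (Literature.Probability.Percolation.BondConfig.relabel
    (Literature.Probability.Percolation.sym2Equiv (Literature.Probability.LatticeModels.Site.shift
    v))) μ) →
    (∀ (γ : Literature.Probability.LatticeModels.zdGraph 3 ≃g
    Literature.Probability.LatticeModels.zdGraph 3) (A : Set
    (Literature.Probability.Percolation.BondConfig (Literature.Probability.LatticeModels.Site 3))),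
    MeasurableSet A → μ (Literature.Probability.Percolation.BondConfig.relabel
    (Literature.Probability.Percolation.sym2Equiv γ.toEquiv) ⁻¹' A) = μ A) →
    (∀ A B : Set (Literature.Probability.Percolation.BondConfig
    (Literature.Probability.LatticeModels.Site 3)), IsUpperSet A → IsUpperSet B → MeasurableSet A →
    MeasurableSet B → μ A * μ B ≤ μ (A ∩ B)) →
    (∀ᵐ ω ∂μ, ∀ (i : Fin 3) (a : ℤ) (v : Literature.Probability.LatticeModels.Site 3), {y :
    Literature.Probability.LatticeModels.Site 3 | ω ∈ Literature.Probability.Percolation.openConnIn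
    {x : Literature.Probability.LatticeModels.Site 3 | a ≤ x i} v y}.Finite ∧ {y :
    Literature.Probability.LatticeModels.Site 3 | ω ∈ Literature.Probability.Percolation.openConnIn
    {x : Literature.Probability.LatticeModels.Site 3 | x i ≤ a} v y}.Finite) →
    (∀ L : ℕ, 1 ≤ L → ∀ (i : Fin 3) (c : Literature.Probability.LatticeModels.Site 3), ∀ᵐ ω ∂μ, ∀ x
    : Literature.Probability.LatticeModels.Site 3, (Literature.Probability.Percolation.openCluster
    (ω \ {e | ∃ y : Literature.Probability.LatticeModels.Site 3, (∀ j, (L : ℤ) ∣ y j - c j) ∧ e =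
    s(y, y + Pi.single i 1)}) x).Finite) →
    (∀ (i : Fin 3) (M : ℕ), Filter.Tendsto (fun k : ℕ => μ.real ({ω |
    (Literature.Probability.Percolation.openCluster ω 0).Infinite} ∩ {ω | {y :
    Literature.Probability.LatticeModels.Site 3 | (∀ j, (2 : ℤ) ^ (k + 1) ∣ y j - 2 ^ k) ∧ s(y, y +
    Pi.single i 1) ∈ ω ∧ (y ∈ Literature.Probability.Percolation.openCluster (ω \ {e | ∃ z :
    Literature.Probability.LatticeModels.Site 3, (∀ j, (2 : ℤ) ^ (k + 1) ∣ z j - 2 ^ k) ∧ e = s(z, z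
    + Pi.single i 1)}) 0 ↔ y + Pi.single i 1 ∉ Literature.Probability.Percolation.openCluster (ω \
    {e | ∃ z : Literature.Probability.LatticeModels.Site 3, (∀ j, (2 : ℤ) ^ (k + 1) ∣ z j - 2 ^ k) ∧
    e = s(z, z + Pi.single i 1)}) 0)}.encard ≤ (M : ℕ∞)})) Filter.atTop (nhds 0)) →
    ∀ (i : Fin 3) (ε : ℝ), 0 < ε → ∃ N : ℕ, ∀ k : ℕ, μ.real {ω | (N : ℕ∞) < {g :
    Literature.Probability.LatticeModels.Site 3 | (∀ j, (2 : ℤ) ^ (k + 1) ∣ g j) ∧ g ∈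
    Literature.Probability.Percolation.openCluster (ω \ {e | ∃ z :
    Literature.Probability.LatticeModels.Site 3, (∀ j, (2 : ℤ) ^ (k + 1) ∣ z j - 2 ^ k) ∧ e = s(z, z
    + Pi.single i 1)}) 0}.encard} ≤ ε := by
  sorry

/-- **STUB 2 `doorTransport`** (L, PROVABLE NOW — the mass-transport step): for every probability
measure `μ` that is automorphism-invariant (H6) and sieve-fragile (H9), every direction `i`, every `N`
and every `ε > 0` there is `M` with `μ ({N_k ≤ N} ∩ {U_k > M}) ≤ ε` for ALL `k`. Proof route: the
translations by `Γ_k = 2^(k+1) ℤ³` are graph automorphisms (`Literature.Probability.Percolation.zdShiftSymmIso`, ZeroOneLaw.lean) preserving `D_k^i`, so the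
transport `m(g, y) = 𝟙{g ∈ Γ_k, y inner endpoint of an open door of the piece of g} / N_k(piece of g)`
is diagonally `Γ_k`-invariant; mass out of `0` is `U_k / N_k` (distinct doors have distinct inner
endpoints; `N_k ≥ 1` by `zero_mem_centres`; `U_k ≤ |P_k| < ∞` a.s. by H9 at `L = 2^(k+1)`,
`c = 2^k 𝟙`), mass into a site is `≤ 1` and vanishes off the two endpoints of the cell's sieve edge, so
MTP for the subgroup `Γ_k` (`Literature.Barriers.CriticalPhenomena.MassTransportPrincipleSubgroup`,
Lyons–Peres Thm. 8.7/(8.10), stabilisers trivial) gives `E[U_k / N_k] ≤ 2`, and Markov gives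
`μ(N_k ≤ N, U_k > M) ≤ 2N/M`; take `M = ⌈2N/ε⌉`. Why it might fail: it should not (an identity plus
Markov); the formalisation cost is the measurability of pieces/doors and the coset Fubini. -/
theorem stub_doorTransport :
  ∀ μ : MeasureTheory.Measure (Literature.Probability.Percolation.BondConfig
  (Literature.Probability.LatticeModels.Site 3)),
    MeasureTheory.IsProbabilityMeasure μ →
    (∀ (γ : Literature.Probability.LatticeModels.zdGraph 3 ≃g
    Literature.Probability.LatticeModels.zdGraph 3) (A : Set
    (Literature.Probability.Percolation.BondConfig (Literature.Probability.LatticeModels.Site 3))),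
    MeasurableSet A → μ (Literature.Probability.Percolation.BondConfig.relabel
    (Literature.Probability.Percolation.sym2Equiv γ.toEquiv) ⁻¹' A) = μ A) →
    (∀ L : ℕ, 1 ≤ L → ∀ (i : Fin 3) (c : Literature.Probability.LatticeModels.Site 3), ∀ᵐ ω ∂μ, ∀ x
    : Literature.Probability.LatticeModels.Site 3, (Literature.Probability.Percolation.openCluster
    (ω \ {e | ∃ y : Literature.Probability.LatticeModels.Site 3, (∀ j, (L : ℤ) ∣ y j - c j) ∧ e =
    s(y, y + Pi.single i 1)}) x).Finite) →
    ∀ (i : Fin 3) (N : ℕ) (ε : ℝ), 0 < ε → ∃ M : ℕ, ∀ k : ℕ, μ.real ({ω | {g :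
    Literature.Probability.LatticeModels.Site 3 | (∀ j, (2 : ℤ) ^ (k + 1) ∣ g j) ∧ g ∈
    Literature.Probability.Percolation.openCluster (ω \ {e | ∃ z :
    Literature.Probability.LatticeModels.Site 3, (∀ j, (2 : ℤ) ^ (k + 1) ∣ z j - 2 ^ k) ∧ e = s(z, z
    + Pi.single i 1)}) 0}.encard ≤ (N : ℕ∞)} ∩ {ω | (M : ℕ∞) < {y :
    Literature.Probability.LatticeModels.Site 3 | (∀ j, (2 : ℤ) ^ (k + 1) ∣ y j - 2 ^ k) ∧ s(y, y +
    Pi.single i 1) ∈ ω ∧ (y ∈ Literature.Probability.Percolation.openCluster (ω \ {e | ∃ z :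
    Literature.Probability.LatticeModels.Site 3, (∀ j, (2 : ℤ) ^ (k + 1) ∣ z j - 2 ^ k) ∧ e = s(z, z
    + Pi.single i 1)}) 0 ↔ y + Pi.single i 1 ∉ Literature.Probability.Percolation.openCluster (ω \
    {e | ∃ z : Literature.Probability.LatticeModels.Site 3, (∀ j, (2 : ℤ) ^ (k + 1) ∣ z j - 2 ^ k) ∧
    e = s(z, z + Pi.single i 1)}) 0)}.encard}) ≤ ε := by
  sorry

/-! ### Name-keyed aliases of the stub statements
`__Registered.stub_X` is the statement of `stub_X` under the registered stub's short name, so that the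
native skeleton audit (`#h21_check_skeleton`: hypotheses admissible iff registered obligations / declared
stubs BY NAME) accepts `FKGSieveRigidity_of : __Registered.stub_… → … → FKGSieveRigidity` (device of
`Cruxes/BGNOffTheFloor/Lines/birth.lean` and `Cruxes/NoBackbone/Lines/birth.lean`). -/
namespace __Registered

/-- Alias of `CellTightness` keyed by the registered stub name. -/
abbrev stub_cellTightness : Prop := CellTightness
/-- Alias of `DoorTransport` keyed by the registered stub name. -/
abbrev stub_doorTransport : Prop := DoorTransport

end __Registered

/-! ## Proved plumbing -/

/-- The origin is a level-`k` lattice point of its own sieved piece: `N_k ≥ 1`. -/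
theorem zero_mem_centres (i : Fin 3) (k : ℕ) (ω : BondConfig (Site 3)) : (0 : Site 3) ∈ centres i k ω :=
  ⟨fun _ => ⟨0, by simp⟩, mem_openCluster_self _ _⟩

/-- `N_k ≥ 1`: the centre count is at least one. -/
theorem one_le_encard_centres (i : Fin 3) (k : ℕ) (ω : BondConfig (Site 3)) :
    1 ≤ (centres i k ω).encard :=
  Set.one_le_encard_iff_nonempty.2 ⟨0, zero_mem_centres i k ω⟩

/-- The crux event is the exit law's event: `percolatesAt 0 = {ω | |C(0)| = ∞}`. -/
theorem percolatesAt_eq : percolatesAt (0 : Site 3) = {ω : BondConfig (Site 3) | (openCluster ω 0).Infinite} :=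
  rfl

/-- **Cover**: a percolating configuration has few doors, or few centres and many doors, or many
centres. -/
theorem cover (i : Fin 3) (k M N : ℕ) {ω : BondConfig (Site 3)} (hω : ω ∈ percolatesAt (0 : Site 3)) :
    ω ∈ (percolatesAt (0 : Site 3) ∩ fewDoors i k M) ∪ (fewCentres i k N ∩ manyDoors i k M) ∪
      manyCentres i k N := by
  rcases le_or_gt (doors i k ω).encard (M : ℕ∞) with h | h
  · exact Or.inl (Or.inl ⟨hω, h⟩)
  · rcases le_or_gt (centres i k ω).encard (N : ℕ∞) with h' | h'
    · exact Or.inl (Or.inr ⟨h', h⟩)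
    · exact Or.inr h'

/-- **Budget**: the three-term union bound. -/
theorem budget3 (μ : Measure (BondConfig (Site 3))) [IsFiniteMeasure μ]
    {A X₁ X₂ X₃ : Set (BondConfig (Site 3))} {ε : ℝ} (hsub : A ⊆ X₁ ∪ X₂ ∪ X₃)
    (h₁ : μ.real X₁ ≤ ε) (h₂ : μ.real X₂ ≤ ε) (h₃ : μ.real X₃ ≤ ε) : μ.real A ≤ 3 * ε := by
  have hA : μ.real A ≤ μ.real (X₁ ∪ X₂ ∪ X₃) := measureReal_mono hsub
  have hU₁ : μ.real (X₁ ∪ X₂ ∪ X₃) ≤ μ.real (X₁ ∪ X₂) + μ.real X₃ := measureReal_union_le _ _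
  have hU₂ : μ.real (X₁ ∪ X₂) ≤ μ.real X₁ + μ.real X₂ := measureReal_union_le _ _
  linarith

/-- From the exit law (a real sequence tending to `0`) extract one level `k` below `ε`. -/
theorem exists_le_of_tendsto_zero {f : ℕ → ℝ} (h : Tendsto f atTop (nhds 0)) {ε : ℝ} (hε : 0 < ε) :
    ∃ k, f k ≤ ε := by
  obtain ⟨k, hk⟩ := (h.eventually (Iic_mem_nhds hε)).exists
  exact ⟨k, hk⟩

/-- A real-valued bound `μ.real A ≤ 3ε` for every `ε > 0` forces `μ A = 0` (finite measure). -/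
theorem measure_eq_zero_of_forall_le (μ : Measure (BondConfig (Site 3))) [IsFiniteMeasure μ]
    {A : Set (BondConfig (Site 3))} (h : ∀ ε : ℝ, 0 < ε → μ.real A ≤ 3 * ε) : μ A = 0 := by
  have h0 : μ.real A ≤ 0 := by
    refine le_of_forall_pos_le_add fun ε hε => ?_
    have := h (ε / 3) (by positivity)
    linarith
  have hz : μ.real A = 0 := le_antisymm h0 measureReal_nonneg
  exact (measureReal_eq_zero_iff (measure_ne_top μ A)).1 hz

/-! ## The composition, by name -/

/-- **`FKGSieveRigidity_of`**: the two registered stubs imply the crux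
`Summit.CriticalPhenomena.PercolationContinuityZ3.Theses.PercSieveRigidity.FKGSieveRigidity`
(kernel-checked; no `sorry` outside the stubs). Proof: fix `μ` with H1–H10 and `ε > 0`; STUB 1 at
direction `0` gives `N` with `μ{N_k > N} ≤ ε` for all `k`; STUB 2 gives `M` with
`μ({N_k ≤ N} ∩ {U_k > M}) ≤ ε` for all `k`; the exit law H10 at `(0, M)` gives a level `k` with
`μ(A ∩ {U_k ≤ M}) ≤ ε`; by `cover` and `budget3`, `μ.real A ≤ 3ε`; hence `μ A = 0`. -/
theorem FKGSieveRigidity_of (hT : __Registered.stub_cellTightness)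
    (hD : __Registered.stub_doorTransport) :
    Summit.CriticalPhenomena.PercolationContinuityZ3.Theses.PercSieveRigidity.FKGSieveRigidity := by
  intro μ h1 h2 h3 h4 h5 h6 h7 h8 h9 h10
  haveI : IsProbabilityMeasure μ := h1
  refine measure_eq_zero_of_forall_le μ fun ε hε => ?_
  obtain ⟨N, hN⟩ := hT μ h1 h2 h3 h4 h5 h6 h7 h8 h9 h10 0 ε hε
  obtain ⟨M, hM⟩ := hD μ h1 h6 h9 0 N ε hε
  obtain ⟨k, hk⟩ := exists_le_of_tendsto_zero (h10 0 M) hε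
  exact budget3 μ (fun ω hω => cover 0 k M N hω) hk (hM k) (hN k)

/-- Wiring check: the registered stubs feed `FKGSieveRigidity_of` as stated (an `example`, so no
`sorry`-tainted proof of the crux enters the environment). -/
example : Summit.CriticalPhenomena.PercolationContinuityZ3.Theses.PercSieveRigidity.FKGSieveRigidity :=
  FKGSieveRigidity_of stub_cellTightness stub_doorTransport

/-! ## Honest-piece checks (informative) -/

/-- The budget is genuinely two-sided: the cover lemma needs BOTH the few-centres/many-doors cell
(STUB 2) and the many-centres cell (STUB 1) — dropping either leaves an uncovered case. Recorded as the
trichotomy behind `cover`. -/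
theorem trichotomy (i : Fin 3) (k M N : ℕ) (ω : BondConfig (Site 3)) :
    ω ∈ fewDoors i k M ∨ ω ∈ fewCentres i k N ∩ manyDoors i k M ∨ ω ∈ manyCentres i k N := by
  rcases le_or_gt (doors i k ω).encard (M : ℕ∞) with h | h
  · exact Or.inl h
  · rcases le_or_gt (centres i k ω).encard (N : ℕ∞) with h' | h'
    · exact Or.inr (Or.inl ⟨h', h⟩)
    · exact Or.inr (Or.inr h')

end Summit.CriticalPhenomena.PercolationContinuityZ3.Cruxes.FKGSieveRigidity.Birth

end
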